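import Literature.MathematicalPhysics.QuantumFieldTheory.Balaban1983to89.T4AxialGaugeSmallField
import Literature.MathematicalPhysics.QuantumFieldTheory.Balaban1983to89.T4WilsonGaugeFlatDirection
import Literature.MathematicalPhysics.QuantumFieldTheory.Balaban1983to89.B15PrelimIntegrations

/-!
# `Balaban1983to89.B15Extension193` — [Balaban1989LargeFieldI] p. 193: the EXTENSION of a regular configuration
# `V_k↾_{Z∩Λᶜ}` to `Λ` through a gauge on the surface `∂⁺Λ` — the printed construction PROVED over `Setup`, and the
# surface-gauge bound PROVED for a parallelepiped `Λ` by face-wise axial gauges (row `B15.Lem@193`)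

statement-level skeleton of published theorems with citation tags; proofs where landed; nothing here is a claim about
the Yang–Mills mass gap.

CITATION HEADER (lean-in-tree rule 2026-08-18).  T. Bałaban, *Large field renormalization. I. The basic step of the 𝐑
operation*, Commun. Math. Phys. **122**, 175–202 (1989), doi:10.1007/BF01257412, bib `Balaban1989LargeFieldI` (cell
paper B15; PDF held `paper:balaban1989-cmp122-large-field-i`, journal page = PDF page + 174; the sentences below were
READ AS AN IMAGE on the x2 render `…/1989-cmp122-large-field-I/1989-cmp122-large-field-I-p019-x2.png`, p. 193).  The
paper is a manuscript UNDER ADJUDICATION by the audit cell `pub-balaban`; nothing of it is asserted here as a fact: every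
hypothesis below is an explicit definition or binder and every conclusion is PROVED (no `sorry`, no new axiom, no new
`def … : Prop` fact).  Mega-formalization `lit-balaban`, reader/typer unit `lit-balaban-r12` (owner of block B15),
generation 5; SKELETON row `B15.Lem@193` of `run/shared/lean/pub/lit-balaban/lit-balaban-r12/ROWS-B15.md` (typed leaf of
record: `B15.PrelimIntegrations.Extension193`, p239014 — an instance of it is PROVED in §4 below).

THE PRINTED TEXT (p. 193, verbatim).  *"Take a configuration V_k defined on Z∩Λ^c and satisfying the regularity condition
|V_k(∂p′) − 1| < ε for p′ ⊂ Z∩Λ^c, ε > 0 is sufficiently small. There are many ways of extending it to the domain Λ. The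
way we describe here depends only on V restricted to ∂⁺Λ = {y∈Λ^c: there exists a nearest neighbor point y′∈Λ, or
⟨y, y′⟩∈Λ}. Introduce a generalized axial gauge on the surface ∂⁺Λ. The configuration V_k↾_{∂⁺Λ} is transformed into a
small configuration V′_k, |V′_k(b′) − 1| < O(1)M²ε for b′ ⊂ ∂⁺Λ. We extend it putting V′_k(b′) = 1 for b′∈Λ. The extended
configuration satisfies the regularity condition |V′_k(∂p′) − 1| < O(1)M²ε for p′ ⊂ Λ∪∂⁺Λ. Now we apply the inverse
gauge transformation on ∂⁺Λ, and we get a configuration V_k defined on the whole domain, equal to the given one on Z∩Λ^c,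
and satisfying the regularity condition |∂V_k − 1| < O(1)M²ε."*

WHAT THIS FILE TYPES AND PROVES (torus carrier `Site P k`, positively oriented bonds `PBond P k`, plaquettes `Plaq P k`,
`GaugeField P k G`, `GaugeField.gaugeAct`, `GaugeField.plaqHol`, `dist1` of `Setup`; any `[GaugeGroup G]`).
* §1 The printed sets: `bdPlus Λ` = `∂⁺Λ` (*"y∈Λ^c: there exists a nearest neighbor point y′∈Λ"*); `Touches Λ b` = the
  bonds *"b′∈Λ"* (at least one end in `Λ` — the bonds set to `1`); `outBonds Λ` = the bonds of `Λᶜ` (both ends off `Λ`,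
  where the given field lives and is kept); `surfBonds Λ` = the bonds *"b′ ⊂ ∂⁺Λ"*; `outPlaqs Λ` = the plaquettes
  *"p′ ⊂ Z∩Λ^c"* (four corners off `Λ`); `nearPlaqs Λ` = the plaquettes *"p′ ⊂ Λ∪∂⁺Λ"*.
* §2 THE CONSTRUCTION, for an arbitrary point set `Λ` and an arbitrary gauge transformation `g` on `Λᶜ` (the *"generalized
  axial gauge on the surface ∂⁺Λ"*, a datum here): `primed Λ g V` = *"V′_k"* (`= V^g` on the bonds of `Λᶜ`, `= 1` on the
  bonds `b′∈Λ`), `extend Λ g V` = *"the inverse gauge transformation"* applied to `V′` (a pure gauge on the bonds meeting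
  `Λ`).  PROVED: `extend_eq_of_mem_outBonds` (*"equal to the given one on Z∩Λ^c"*), `plaqHol_extend_of_mem_outPlaqs` (the
  plaquettes of `Λᶜ` keep their variables), `gaugeAct_cutoff_extend` (`V̂^g = V′`), and the regularity transfer
  `dist1_plaqHol_extend_le` : if `|V^g(b′) − 1| ≤ δ′` on the bonds `b′ ⊂ ∂⁺Λ` then `|V̂(∂p′) − 1| ≤ 4δ′` for every
  `p′ ⊂ Λ∪∂⁺Λ` (the two inverted letters of `U(∂p)` by `dist1_inv`, subadditivity `dist1_mul_le`, and gauge covariance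
  `T4WilsonGaugeFlatDirection.plaqHol_gaugeAct` + `B11GaugeGlue.dist1_conj_inv`, all BY NAME).
* §3 THE SURFACE GAUGE FOR A PARALLELEPIPED.  For `Λ = boxSites lo hi` (the image on the torus of the integer box
  `[lo, hi] ⊂ ℤ^d`, non-wrapping with a margin: `hi κ − lo κ + 3 < sitesPerDir`), the surface `∂⁺Λ` is covered by the
  `2d` faces `faceSites lo hi ν s` (degenerate boxes one lattice step off the faces of `Λ`; `exists_face_of_mem_bdPlus`),
  the faces are pairwise DISJOINT (`face_unique`), no bond joins two different faces (`surfBond_face`), and the plaquettes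
  of a face lie in `Λᶜ` (`boxPlaqs_face_subset_outPlaqs`).  Hence the face-wise
  axial gauges of `T4AxialGaugeSmallField` (`axialGauge`, rooted at the corner of each face) assemble into ONE gauge
  transformation `faceGauge V lo hi` on `∂⁺Λ`, and `T4AxialGaugeSmallField.dist1_gaugeAct_axialGauge_le_uniform` (the torus
  non-abelian Poincaré lemma, BY NAME) gives `|V^{faceGauge}(b′) − 1| ≤ (d − 1)·n·ε` on every `b′ ⊂ ∂⁺Λ` for a box of at
  most `n + 1` sites per direction (`dist1_faceGauge_le`).  So the printed *"O(1)M²ε"* holds with `(d − 1)(M − 1)ε` for an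
  `M`-cube.
* §4 ASSEMBLY: `extension_box` (the three conclusions for a box) and `extension193_box` — the typed leaf
  `B15.PrelimIntegrations.Extension193 (outBonds Λ) (outPlaqs Λ) (nearPlaqs Λ ∪ outPlaqs Λ) (4(d − 1)) M ε` PROVED for
  every box `Λ` of at most `M` sites per direction (`M ≥ n + 1`), every `ε`, every `GaugeGroup`.

HONEST SCOPE / READING NOTES.
(R1) `Λ` of p. 193 is `(Ω^{∼4}_{k₀+1})ᶜ ∩ Z` (1.73), a union of `M`-cubes; §3–§4 discharge the surface gauge only for ONE
parallelepiped (all components of the regions `Z″_j` are rectangular parallelepipeds, p. 179, but `Λ` need not be one);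
for general `Λ` the surface-gauge smallness stays the HYPOTHESIS of §2 (`extension193_of_surfaceGauge`), exactly the
printed intermediate claim *"V_k↾_{∂⁺Λ} is transformed into a small configuration V′_k"* (generalized axial gauges: [14]).
(R2) (GAPS.md G-B15-02, reading note, nothing repaired.)  The printed regularity conclusions cover the plaquettes
`p′ ⊂ Λ∪∂⁺Λ` and (trivially) `p′ ⊂ Λᶜ`.  A plaquette with one vertex in `Λ` and the opposite vertex OUTSIDE `Λ ∪ ∂⁺Λ` (it
exists at every convex edge of `Λ`, e.g. `p = ⟨x, x+e_μ, x+e_μ+e_ν, x+e_ν⟩` with `x` on an edge of a cube `Λ`: the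
diagonal vertex `x+e_μ+e_ν` has no nearest neighbour in `Λ`) is in neither class; for it `V̂(∂p)` is conjugate to
`g(x+e_μ)V(x+e_μ, x+e_μ+e_ν)V(x+e_ν, x+e_ν+e_μ)⁻¹g(x+e_ν)⁻¹`, which the face-wise gauges do not make small.  `allP` of
§4 is therefore `nearPlaqs Λ ∪ outPlaqs Λ`, and `not_mem_allPlaqs_iff` records exactly which plaquettes are left out.
(R3) The constant: the printed `O(1)M²` is met with room — `(d − 1)(M − 1)` per surface bond, `4(d − 1)(M − 1)` per
plaquette (`< 4(d − 1)M²`).  (R4) `PlaqSmallOn` of `Setup` is strict (`<`); intermediate bounds are `≤`.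
(R5) Nothing here concerns measures, the background field `U_{k,Z}` or the consequences drawn on p. 193 for `χ_{k,Λ}`
(their arithmetic is `B15.PrelimIntegrations.largeField193`).
-/

noncomputable section

open Set

namespace Literature.MathematicalPhysics.QuantumFieldTheory.Balaban1983to89.B15Extension193

open GaugeField (gaugeAct plaqHol)
open T4AxialGaugeSmallField (castSite castSite_apply castSite_add_e castSite_injOn_box boxPlaqs boxBonds axialGauge
  dist1_gaugeAct_axialGauge_le_uniform)
open B7Prop1Explicit (e e_apply)
open B8Lemma1NonAbelian (e_nonneg)

variable {P : Params} {k : ℕ} {G : Type*}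

/-! ## §1  The printed sets: `∂⁺Λ`, the bonds «b′ ∈ Λ», the bonds and plaquettes of `Λᶜ`, the plaquettes `p′ ⊂ Λ ∪ ∂⁺Λ` -/

section Geometry

variable (Λ : Set (Site P k))

/-- `∂⁺Λ`, p. 193 verbatim: *"∂⁺Λ = {y∈Λ^c: there exists a nearest neighbor point y′∈Λ, or ⟨y, y′⟩∈Λ}"* — the points off
`Λ` with a nearest neighbour `x ∈ Λ` (`y = x + e_μ` or `y = x − e_μ`). [cite: Balaban1989LargeFieldI, p.193] -/
def bdPlus : Set (Site P k) := {y | y ∉ Λ ∧ ∃ x ∈ Λ, ∃ μ : Fin P.d, y = x.shift μ ∨ x = y.shift μ}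

/-- The bonds *"b′∈Λ"* of p. 193 (those on which the extended configuration is PUT EQUAL TO `1` in the primed gauge): the
bonds with at least one end in `Λ`. [cite: Balaban1989LargeFieldI, p.193] -/
def Touches (b : PBond P k) : Prop := b.src ∈ Λ ∨ b.tgt ∈ Λ

/-- The bonds of `Z∩Λ^c` (both ends off `Λ`): where the given configuration lives and is kept, p. 193 *"equal to the
given one on Z∩Λ^c"*. [cite: Balaban1989LargeFieldI, p.193] -/
def outBonds : Set (PBond P k) := {b | b.src ∉ Λ ∧ b.tgt ∉ Λ}

/-- The surface bonds *"b′ ⊂ ∂⁺Λ"* (both ends in `∂⁺Λ`). [cite: Balaban1989LargeFieldI, p.193] -/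
def surfBonds : Set (PBond P k) := {b | b.src ∈ bdPlus Λ ∧ b.tgt ∈ bdPlus Λ}

/-- The four corners `x, x+e_μ, x+e_ν, x+e_μ+e_ν` of a plaquette. [cite: Balaban1989LargeFieldI, p.193] -/
def corners (p : Plaq P k) : List (Site P k) := [p.src, p.src.shift p.μ, p.src.shift p.ν, (p.src.shift p.μ).shift p.ν]

/-- The plaquettes *"p′ ⊂ Z∩Λ^c"* (all four corners off `Λ`) — where the given regularity `|V_k(∂p′) − 1| < ε` is assumed.
[cite: Balaban1989LargeFieldI, p.193] -/
def outPlaqs : Set (Plaq P k) := {p | ∀ c ∈ corners p, c ∉ Λ}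

/-- The plaquettes *"p′ ⊂ Λ∪∂⁺Λ"* (all four corners in `Λ ∪ ∂⁺Λ`) — where the regularity of the extension is asserted.
[cite: Balaban1989LargeFieldI, p.193] -/
def nearPlaqs : Set (Plaq P k) := {p | ∀ c ∈ corners p, c ∈ Λ ∨ c ∈ bdPlus Λ}

/-- The plaquette class covered by the two printed regularity sentences: `p′ ⊂ Λ∪∂⁺Λ` or `p′ ⊂ Λᶜ`.
[cite: Balaban1989LargeFieldI, p.193] -/
def allPlaqs : Set (Plaq P k) := nearPlaqs Λ ∪ outPlaqs Λ

variable {Λ}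

/-- A bond not «in Λ» is a bond of `Λᶜ`. [cite: Balaban1989LargeFieldI, p.193] -/
theorem mem_outBonds_iff_not_touches (b : PBond P k) : b ∈ outBonds Λ ↔ ¬ Touches Λ b := by
  simp only [outBonds, Touches, mem_setOf_eq, not_or]

/-- Surface bonds are bonds of `Λᶜ`. [cite: Balaban1989LargeFieldI, p.193] -/
theorem surfBonds_subset_outBonds : surfBonds Λ ⊆ outBonds Λ := fun _ hb => ⟨hb.1.1, hb.2.1⟩

/-- `∂⁺Λ ⊆ Λᶜ`. [cite: Balaban1989LargeFieldI, p.193] -/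
theorem bdPlus_subset_compl : bdPlus Λ ⊆ Λᶜ := fun _ hy => hy.1

/-- READING NOTE (R2): the plaquettes NOT covered by the two printed regularity sentences are exactly those with a corner in
`Λ` and a corner outside `Λ ∪ ∂⁺Λ`. [cite: Balaban1989LargeFieldI, p.193] -/
theorem not_mem_allPlaqs_iff (p : Plaq P k) :
    p ∉ allPlaqs Λ ↔ (∃ c ∈ corners p, c ∈ Λ) ∧ ∃ c ∈ corners p, c ∉ Λ ∧ c ∉ bdPlus Λ := by
  simp only [allPlaqs, nearPlaqs, outPlaqs, mem_union, mem_setOf_eq, not_or, not_forall, not_not, exists_prop]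
  constructor
  · rintro ⟨⟨c, hc, hc'⟩, c', hc'm, hc'Λ⟩
    exact ⟨⟨c', hc'm, hc'Λ⟩, c, hc, hc'.1, hc'.2⟩
  · rintro ⟨⟨c', hc'm, hc'Λ⟩, c, hc, hcΛ, hcb⟩
    exact ⟨⟨c, hc, hcΛ, hcb⟩, c', hc'm, hc'Λ⟩

end Geometry

/-! ## §2  The construction: `V′` (gauge on `Λᶜ`, `1` on the bonds «in Λ») and the extension `V̂ = (V′)^{g⁻¹}` -/

section Construction

variable [GaugeGroup G] (Λ : Set (Site P k))

open Classical in
/-- The gauge transformation of p. 193 acts *"on ∂⁺Λ"* (more generally off `Λ`) and trivially on `Λ`: `g` cut off to `1`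
on `Λ`. [cite: Balaban1989LargeFieldI, p.193] -/
def cutoff (g : GaugeTransf P k G) : GaugeTransf P k G := fun y => if y ∈ Λ then 1 else g y

open Classical in
/-- *"V′_k"* of p. 193: the gauge-transformed given configuration `V^g` on the bonds of `Λᶜ`, and *"we extend it putting
V′_k(b′) = 1 for b′∈Λ"*. [cite: Balaban1989LargeFieldI, p.193] -/
def primed (g : GaugeTransf P k G) (V : GaugeField P k G) : GaugeField P k G :=
  fun b => if Touches Λ b then 1 else gaugeAct (cutoff Λ g) V b

/-- The EXTENSION of p. 193: *"Now we apply the inverse gauge transformation on ∂⁺Λ, and we get a configuration V_k defined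
on the whole domain"* — `V̂ = (V′)^{g⁻¹}`. [cite: Balaban1989LargeFieldI, p.193] -/
def extend (g : GaugeTransf P k G) (V : GaugeField P k G) : GaugeField P k G :=
  gaugeAct (fun y => (cutoff Λ g y)⁻¹) (primed Λ g V)

variable {Λ}

/-- `cutoff g = 1` on `Λ`. [cite: Balaban1989LargeFieldI, p.193] -/
theorem cutoff_of_mem (g : GaugeTransf P k G) {y : Site P k} (hy : y ∈ Λ) : cutoff Λ g y = 1 := by
  simp [cutoff, hy]

/-- `cutoff g = g` off `Λ`. [cite: Balaban1989LargeFieldI, p.193] -/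
theorem cutoff_of_not_mem (g : GaugeTransf P k G) {y : Site P k} (hy : y ∉ Λ) : cutoff Λ g y = g y := by
  simp [cutoff, hy]

/-- `V′ = 1` on the bonds «in Λ». [cite: Balaban1989LargeFieldI, p.193] -/
theorem primed_of_touches (g : GaugeTransf P k G) (V : GaugeField P k G) {b : PBond P k} (hb : Touches Λ b) :
    primed Λ g V b = 1 := by
  simp [primed, hb]

/-- `V′ = V^g` on the bonds of `Λᶜ`. [cite: Balaban1989LargeFieldI, p.193] -/
theorem primed_of_mem_outBonds (g : GaugeTransf P k G) (V : GaugeField P k G) {b : PBond P k} (hb : b ∈ outBonds Λ) :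
    primed Λ g V b = gaugeAct g V b := by
  have hb' := (mem_outBonds_iff_not_touches b).1 hb
  simp only [primed, hb', if_false, GaugeField.gaugeAct, cutoff_of_not_mem g hb.1, cutoff_of_not_mem g hb.2]

/-- *"equal to the given one on Z∩Λ^c"*: on the bonds of `Λᶜ` the extension IS the given configuration.
[cite: Balaban1989LargeFieldI, p.193] -/
theorem extend_eq_of_mem_outBonds (g : GaugeTransf P k G) (V : GaugeField P k G) {b : PBond P k}
    (hb : b ∈ outBonds Λ) : extend Λ g V b = V b := by
  simp only [extend, GaugeField.gaugeAct, primed_of_mem_outBonds g V hb, cutoff_of_not_mem g hb.1,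
    cutoff_of_not_mem g hb.2, inv_inv]
  group

/-- On a bond «in Λ» the extension is the pure gauge `g(b₋)⁻¹ g(b₊)` (with `g` cut off to `1` on `Λ`).
[cite: Balaban1989LargeFieldI, p.193] -/
theorem extend_of_touches (g : GaugeTransf P k G) (V : GaugeField P k G) {b : PBond P k} (hb : Touches Λ b) :
    extend Λ g V b = (cutoff Λ g b.src)⁻¹ * cutoff Λ g b.tgt := by
  simp only [extend, GaugeField.gaugeAct, primed_of_touches g V hb, mul_one, inv_inv]

/-- In particular the extension is `1` on the bonds with both ends in `Λ`. [cite: Balaban1989LargeFieldI, p.193] -/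
theorem extend_of_mem_of_mem (g : GaugeTransf P k G) (V : GaugeField P k G) {b : PBond P k} (h₁ : b.src ∈ Λ)
    (h₂ : b.tgt ∈ Λ) : extend Λ g V b = 1 := by
  rw [extend_of_touches g V (Or.inl h₁), cutoff_of_mem g h₁, cutoff_of_mem g h₂, inv_one, one_mul]

/-- `V̂^g = V′`: transforming the extension back with the (cut-off) surface gauge gives the primed configuration.
[cite: Balaban1989LargeFieldI, p.193] -/
theorem gaugeAct_cutoff_extend (g : GaugeTransf P k G) (V : GaugeField P k G) :
    gaugeAct (cutoff Λ g) (extend Λ g V) = primed Λ g V := by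
  funext b
  simp only [extend, GaugeField.gaugeAct]
  group

/-- The plaquette variables of the extension are conjugate to those of `V′`: `V̂(∂p) = g(p₋)⁻¹ V′(∂p) g(p₋)`.
[cite: Balaban1989LargeFieldI, p.193] -/
theorem plaqHol_extend (g : GaugeTransf P k G) (V : GaugeField P k G) (p : Plaq P k) :
    plaqHol (extend Λ g V) p = (cutoff Λ g p.src)⁻¹ * plaqHol (primed Λ g V) p * cutoff Λ g p.src := by
  have h := T4WilsonGaugeFlatDirection.plaqHol_gaugeAct (fun y => (cutoff Λ g y)⁻¹) (primed Λ g V) p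
  rw [inv_inv] at h
  exact h

/-- Hence `|V̂(∂p) − 1| = |V′(∂p) − 1|` for every plaquette. [cite: Balaban1989LargeFieldI, p.193] -/
theorem dist1_plaqHol_extend (g : GaugeTransf P k G) (V : GaugeField P k G) (p : Plaq P k) :
    dist1 (plaqHol (extend Λ g V) p) = dist1 (plaqHol (primed Λ g V) p) := by
  rw [plaqHol_extend, B11GaugeGlue.dist1_conj_inv]

/-- The corners of a plaquette, unfolded. [cite: Balaban1989LargeFieldI, p.193] -/
theorem mem_corners_iff (p : Plaq P k) (c : Site P k) :
    c ∈ corners p ↔ c = p.src ∨ c = p.src.shift p.μ ∨ c = p.src.shift p.ν ∨ c = (p.src.shift p.μ).shift p.ν := by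
  simp [corners]

/-- On a plaquette of `Λᶜ` none of the four bonds is «in Λ», so the extension has the GIVEN plaquette variable there.
[cite: Balaban1989LargeFieldI, p.193] -/
theorem plaqHol_extend_of_mem_outPlaqs (g : GaugeTransf P k G) (V : GaugeField P k G) {p : Plaq P k}
    (hp : p ∈ outPlaqs Λ) : plaqHol (extend Λ g V) p = plaqHol V p := by
  have h1 : p.src ∉ Λ := hp _ ((mem_corners_iff p _).2 (Or.inl rfl))
  have h2 : p.src.shift p.μ ∉ Λ := hp _ ((mem_corners_iff p _).2 (Or.inr (Or.inl rfl)))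
  have h3 : p.src.shift p.ν ∉ Λ := hp _ ((mem_corners_iff p _).2 (Or.inr (Or.inr (Or.inl rfl))))
  have h4 : (p.src.shift p.μ).shift p.ν ∉ Λ := hp _ ((mem_corners_iff p _).2 (Or.inr (Or.inr (Or.inr rfl))))
  have h4' : (p.src.shift p.ν).shift p.μ ∉ Λ := by rwa [Site.shift_comm]
  simp only [GaugeField.plaqHol]
  rw [extend_eq_of_mem_outBonds g V (b := ⟨p.src, p.μ⟩) ⟨h1, h2⟩,
    extend_eq_of_mem_outBonds g V (b := ⟨p.src.shift p.μ, p.ν⟩) ⟨h2, h4⟩,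
    extend_eq_of_mem_outBonds g V (b := ⟨p.src.shift p.ν, p.μ⟩) ⟨h3, h4'⟩,
    extend_eq_of_mem_outBonds g V (b := ⟨p.src, p.ν⟩) ⟨h1, h3⟩]

/-- On a plaquette `p′ ⊂ Λ∪∂⁺Λ` every bond is either «in Λ» (where `V′ = 1`) or a surface bond `b′ ⊂ ∂⁺Λ` (where
`V′ = V^g`); so `|V′(b) − 1| ≤ δ′` on all four bonds as soon as `|V^g(b′) − 1| ≤ δ′` on the surface bonds.
[cite: Balaban1989LargeFieldI, p.193] -/
theorem dist1_primed_le_of_mem_nearPlaqs (g : GaugeTransf P k G) (V : GaugeField P k G) {δ' : ℝ} (hδ' : 0 ≤ δ')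
    (hsurf : ∀ b ∈ surfBonds Λ, dist1 (gaugeAct g V b) ≤ δ') {p : Plaq P k} (hp : p ∈ nearPlaqs Λ) {b : PBond P k}
    (hsrc : b.src ∈ corners p) (htgt : b.tgt ∈ corners p) : dist1 (primed Λ g V b) ≤ δ' := by
  by_cases hb : Touches Λ b
  · rw [primed_of_touches g V hb, GaugeGroup.dist1_one]
    exact hδ'
  · have hout : b ∈ outBonds Λ := (mem_outBonds_iff_not_touches b).2 hb
    have hs : b.src ∈ bdPlus Λ := (hp _ hsrc).resolve_left hout.1
    have ht : b.tgt ∈ bdPlus Λ := (hp _ htgt).resolve_left hout.2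
    rw [primed_of_mem_outBonds g V hout]
    exact hsurf b ⟨hs, ht⟩

/-- **THE REGULARITY TRANSFER** of p. 193: if the surface gauge makes `|V^g(b′) − 1| ≤ δ′` for the bonds `b′ ⊂ ∂⁺Λ`, then
the extension satisfies `|V̂(∂p′) − 1| ≤ 4δ′` for every plaquette `p′ ⊂ Λ∪∂⁺Λ` (*"The extended configuration satisfies the
regularity condition … for p′ ⊂ Λ∪∂⁺Λ. Now we apply the inverse gauge transformation …"*: `V̂(∂p′)` is conjugate to
`V′(∂p′)`, a word in four letters each within `δ′` of `1`). [cite: Balaban1989LargeFieldI, p.193] -/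
theorem dist1_plaqHol_extend_le (g : GaugeTransf P k G) (V : GaugeField P k G) {δ' : ℝ} (hδ' : 0 ≤ δ')
    (hsurf : ∀ b ∈ surfBonds Λ, dist1 (gaugeAct g V b) ≤ δ') {p : Plaq P k} (hp : p ∈ nearPlaqs Λ) :
    dist1 (plaqHol (extend Λ g V) p) ≤ 4 * δ' := by
  rw [dist1_plaqHol_extend]
  set W := primed Λ g V with hW
  have c1 : p.src ∈ corners p := (mem_corners_iff p _).2 (Or.inl rfl)
  have c2 : p.src.shift p.μ ∈ corners p := (mem_corners_iff p _).2 (Or.inr (Or.inl rfl))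
  have c3 : p.src.shift p.ν ∈ corners p := (mem_corners_iff p _).2 (Or.inr (Or.inr (Or.inl rfl)))
  have c4 : (p.src.shift p.μ).shift p.ν ∈ corners p := (mem_corners_iff p _).2 (Or.inr (Or.inr (Or.inr rfl)))
  have c4' : (p.src.shift p.ν).shift p.μ ∈ corners p := by rw [← Site.shift_comm]; exact c4
  have hb1 : dist1 (W ⟨p.src, p.μ⟩) ≤ δ' := dist1_primed_le_of_mem_nearPlaqs g V hδ' hsurf hp (b := ⟨p.src, p.μ⟩) c1 c2
  have hb2 : dist1 (W ⟨p.src.shift p.μ, p.ν⟩) ≤ δ' :=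
    dist1_primed_le_of_mem_nearPlaqs g V hδ' hsurf hp (b := ⟨p.src.shift p.μ, p.ν⟩) c2 c4
  have hb3 : dist1 (W ⟨p.src.shift p.ν, p.μ⟩) ≤ δ' :=
    dist1_primed_le_of_mem_nearPlaqs g V hδ' hsurf hp (b := ⟨p.src.shift p.ν, p.μ⟩) c3 c4'
  have hb4 : dist1 (W ⟨p.src, p.ν⟩) ≤ δ' := dist1_primed_le_of_mem_nearPlaqs g V hδ' hsurf hp (b := ⟨p.src, p.ν⟩) c1 c3
  unfold GaugeField.plaqHol
  have h₁ := GaugeGroup.dist1_mul_le (W ⟨p.src, p.μ⟩ * W ⟨p.src.shift p.μ, p.ν⟩ * (W ⟨p.src.shift p.ν, p.μ⟩)⁻¹)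
    (W ⟨p.src, p.ν⟩)⁻¹
  have h₂ := GaugeGroup.dist1_mul_le (W ⟨p.src, p.μ⟩ * W ⟨p.src.shift p.μ, p.ν⟩) (W ⟨p.src.shift p.ν, p.μ⟩)⁻¹
  have h₃ := GaugeGroup.dist1_mul_le (W ⟨p.src, p.μ⟩) (W ⟨p.src.shift p.μ, p.ν⟩)
  rw [GaugeGroup.dist1_inv] at h₁ h₂
  linarith

/-- **THE PRINTED CONSTRUCTION, ASSEMBLED (general `Λ`, surface gauge as a datum)**: given a gauge transformation `g` with
`|V^g(b′) − 1| ≤ δ′` on the bonds `b′ ⊂ ∂⁺Λ` (p. 193: *"V_k↾_{∂⁺Λ} is transformed into a small configuration V′_k"*), the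
extension `V̂ = extend Λ g V` (i) equals `V` on the bonds of `Λᶜ`, (ii) has the given plaquette variables on the plaquettes of
`Λᶜ`, and (iii) satisfies `|V̂(∂p′) − 1| ≤ 4δ′` for `p′ ⊂ Λ∪∂⁺Λ`. [cite: Balaban1989LargeFieldI, p.193] -/
theorem extension_of_surfaceGauge (g : GaugeTransf P k G) (V : GaugeField P k G) {δ' : ℝ} (hδ' : 0 ≤ δ')
    (hsurf : ∀ b ∈ surfBonds Λ, dist1 (gaugeAct g V b) ≤ δ') :
    (∀ b ∈ outBonds Λ, extend Λ g V b = V b) ∧ (∀ p ∈ outPlaqs Λ, plaqHol (extend Λ g V) p = plaqHol V p) ∧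
      ∀ p ∈ nearPlaqs Λ, dist1 (plaqHol (extend Λ g V) p) ≤ 4 * δ' :=
  ⟨fun _ hb => extend_eq_of_mem_outBonds g V hb, fun _ hp => plaqHol_extend_of_mem_outPlaqs g V hp,
    fun _ hp => dist1_plaqHol_extend_le g V hδ' hsurf hp⟩

/-- The typed leaf `B15.PrelimIntegrations.Extension193` for a general `Λ`, MODULO the surface gauge: if for every
`ε`-regular `V` on `Λᶜ` some gauge transformation makes `|V^g(b′) − 1| ≤ C′ε` on the bonds `b′ ⊂ ∂⁺Λ` (the generalized
axial gauge of [14], printed with `C′ = O(1)M²`), then the extension lemma holds on the plaquette class `p′ ⊂ Λ∪∂⁺Λ` or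
`p′ ⊂ Λᶜ` with any constant `C M² > max(4C′, 1)` (for `ε > 0`). [cite: Balaban1989LargeFieldI, p.193] -/
theorem extension193_of_surfaceGauge {ε C C' M : ℝ} (hε : 0 < ε) (hC' : 0 ≤ C')
    (hgauge : ∀ V : GaugeField P k G, PlaqSmallOn (outPlaqs Λ) ε V →
      ∃ g : GaugeTransf P k G, ∀ b ∈ surfBonds Λ, dist1 (gaugeAct g V b) ≤ C' * ε)
    (h4 : 4 * C' < C * M ^ 2) (h1 : 1 ≤ C * M ^ 2) :
    B15.PrelimIntegrations.Extension193 (G := G) (outBonds Λ) (outPlaqs Λ) (allPlaqs Λ) C M ε := by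
  intro V hV
  obtain ⟨g, hg⟩ := hgauge V hV
  obtain ⟨hout, hplaq, hnear⟩ := extension_of_surfaceGauge g V (mul_nonneg hC' hε.le) hg
  refine ⟨extend Λ g V, hout, fun p hp => ?_⟩
  rcases hp with hp | hp
  · calc dist1 (plaqHol (extend Λ g V) p) ≤ 4 * (C' * ε) := hnear p hp
      _ < C * M ^ 2 * ε := by nlinarith
  · rw [hplaq p hp]
    calc dist1 (plaqHol V p) < ε := hV p hp
      _ ≤ C * M ^ 2 * ε := by nlinarith

end Construction

/-! ## §3  `Λ` a parallelepiped: `∂⁺Λ` is the disjoint union of the `2d` faces, and the face-wise axial gauges -/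

section Box

variable {lo hi : Fin P.d → ℤ}

/-- The torus image `Λ` of the integer box `[lo, hi] ⊂ ℤ^d` (a rectangular parallelepiped, p. 179: *"all components of the
domains Z″_j are also rectangular parallelepipeds"*; `castSite` of `T4AxialGaugeSmallField`). [cite: Balaban1989LargeFieldI, p.193] -/
def boxSites (lo hi : Fin P.d → ℤ) : Set (Site P k) := {y | ∃ x : Fin P.d → ℤ, lo ≤ x ∧ x ≤ hi ∧ castSite x = y}

/-- The out-of-range coordinate of the face `(ν, s)` of `∂⁺Λ`: `hi ν + 1` (upper face, `s = true`) or `lo ν − 1` (lower).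
[cite: Balaban1989LargeFieldI, p.193] -/
def faceCoord (lo hi : Fin P.d → ℤ) (ν : Fin P.d) (s : Bool) : ℤ := if s then hi ν + 1 else lo ν - 1

/-- Lower corner of the face box `(ν, s)` (a degenerate box: thickness `0` in direction `ν`). [cite: Balaban1989LargeFieldI, p.193] -/
def faceLo (lo hi : Fin P.d → ℤ) (ν : Fin P.d) (s : Bool) : Fin P.d → ℤ := Function.update lo ν (faceCoord lo hi ν s)

/-- Upper corner of the face box `(ν, s)`. [cite: Balaban1989LargeFieldI, p.193] -/
def faceHi (lo hi : Fin P.d → ℤ) (ν : Fin P.d) (s : Bool) : Fin P.d → ℤ := Function.update hi ν (faceCoord lo hi ν s)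

/-- The torus image of the face box `(ν, s)`. [cite: Balaban1989LargeFieldI, p.193] -/
def faceSites (lo hi : Fin P.d → ℤ) (ν : Fin P.d) (s : Bool) : Set (Site P k) :=
  {y | ∃ x : Fin P.d → ℤ, faceLo lo hi ν s ≤ x ∧ x ≤ faceHi lo hi ν s ∧ castSite x = y}

/-- Membership in the face box: coordinate `ν` equals the face coordinate, the others lie in `[lo, hi]`.
[cite: Balaban1989LargeFieldI, p.193] -/
theorem mem_faceBox_iff {ν : Fin P.d} {s : Bool} {x : Fin P.d → ℤ} :
    faceLo lo hi ν s ≤ x ∧ x ≤ faceHi lo hi ν s ↔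
      x ν = faceCoord lo hi ν s ∧ ∀ κ, κ ≠ ν → lo κ ≤ x κ ∧ x κ ≤ hi κ := by
  simp only [faceLo, faceHi, Pi.le_def, Function.update_apply]
  constructor
  · rintro ⟨h1, h2⟩
    refine ⟨le_antisymm (by simpa using h2 ν) (by simpa using h1 ν), fun κ hκ => ⟨?_, ?_⟩⟩
    · simpa [hκ] using h1 κ
    · simpa [hκ] using h2 κ
  · rintro ⟨hν, h⟩
    refine ⟨fun κ => ?_, fun κ => ?_⟩
    · by_cases hκ : κ = ν
      · subst hκ; simp [hν]
      · simpa [hκ] using (h κ hκ).1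
    · by_cases hκ : κ = ν
      · subst hκ; simp [hν]
      · simpa [hκ] using (h κ hκ).2

/-- The face coordinate is out of the range `[lo ν, hi ν]`. [cite: Balaban1989LargeFieldI, p.193] -/
theorem faceCoord_not_mem (ν : Fin P.d) (s : Bool) : ¬ (lo ν ≤ faceCoord lo hi ν s ∧ faceCoord lo hi ν s ≤ hi ν) := by
  cases s <;> simp [faceCoord]

/-- … and stays in `[lo ν − 1, hi ν + 1]` when `lo ≤ hi`. [cite: Balaban1989LargeFieldI, p.193] -/
theorem faceCoord_mem (hlohi : lo ≤ hi) (ν : Fin P.d) (s : Bool) :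
    lo ν - 1 ≤ faceCoord lo hi ν s ∧ faceCoord lo hi ν s ≤ hi ν + 1 := by
  have := hlohi ν
  cases s <;> simp [faceCoord] <;> linarith

/-- Injectivity of the face coordinate in the side `s` (for `lo ≤ hi`). [cite: Balaban1989LargeFieldI, p.193] -/
theorem faceCoord_inj (hlohi : lo ≤ hi) {ν : Fin P.d} {s s' : Bool} (h : faceCoord lo hi ν s = faceCoord lo hi ν s') :
    s = s' := by
  have := hlohi ν
  cases s <;> cases s'
  · rfl
  · simp [faceCoord] at h; linarith
  · simp [faceCoord] at h; linarith
  · rfl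

/-- THE BIG BOX `[lo − 1, hi + 2]` containing `Λ`, `∂⁺Λ` and one more step: `castSite` is injective on it under the margin
hypothesis `hi κ − lo κ + 3 < sitesPerDir`. [cite: Balaban1989LargeFieldI, p.193] -/
theorem castSite_inj_big (hN : ∀ κ, hi κ - lo κ + 3 < (P.sitesPerDir k : ℤ)) {x x' : Fin P.d → ℤ}
    (hx : ∀ κ, lo κ - 1 ≤ x κ) (hx' : ∀ κ, x κ ≤ hi κ + 2) (hy : ∀ κ, lo κ - 1 ≤ x' κ) (hy' : ∀ κ, x' κ ≤ hi κ + 2)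
    (h : (castSite x : Site P k) = castSite x') : x = x' :=
  castSite_injOn_box (j := k) (lo := fun κ => lo κ - 1) (hi := fun κ => hi κ + 2)
    (fun κ => by have := hN κ; show hi κ + 2 - (lo κ - 1) < (P.sitesPerDir k : ℤ); linarith) hx hx' hy hy' h

/-- A point of the big box with one coordinate out of `[lo ν, hi ν]` is NOT a point of `Λ`. [cite: Balaban1989LargeFieldI, p.193] -/
theorem castSite_not_mem_boxSites (hN : ∀ κ, hi κ - lo κ + 3 < (P.sitesPerDir k : ℤ)) {w : Fin P.d → ℤ}
    (hw : ∀ κ, lo κ - 1 ≤ w κ) (hw' : ∀ κ, w κ ≤ hi κ + 2) {ν : Fin P.d} (hν : ¬ (lo ν ≤ w ν ∧ w ν ≤ hi ν)) :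
    (castSite w : Site P k) ∉ boxSites lo hi := by
  rintro ⟨z, hz, hz', hzw⟩
  have heq : z = w := castSite_inj_big hN (fun κ => by have := hz κ; linarith) (fun κ => by have := hz' κ; linarith)
    hw hw' hzw
  subst heq
  exact hν ⟨hz ν, hz' ν⟩

/-- Points of a face box lie in the big box. [cite: Balaban1989LargeFieldI, p.193] -/
theorem face_mem_big (hlohi : lo ≤ hi) {ν : Fin P.d} {s : Bool} {x : Fin P.d → ℤ}
    (hx : faceLo lo hi ν s ≤ x ∧ x ≤ faceHi lo hi ν s) : (∀ κ, lo κ - 1 ≤ x κ) ∧ ∀ κ, x κ ≤ hi κ + 1 := by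
  rw [mem_faceBox_iff] at hx
  obtain ⟨hν, h⟩ := hx
  have hc := faceCoord_mem hlohi ν s
  refine ⟨fun κ => ?_, fun κ => ?_⟩
  · by_cases hκ : κ = ν
    · subst hκ; rw [hν]; exact hc.1
    · have := (h κ hκ).1; linarith
  · by_cases hκ : κ = ν
    · subst hκ; rw [hν]; exact hc.2
    · have := (h κ hκ).2; linarith

/-- Face points are NOT points of `Λ` (their `ν`-coordinate is out of range). [cite: Balaban1989LargeFieldI, p.193] -/
theorem castSite_face_not_mem (hlohi : lo ≤ hi) (hN : ∀ κ, hi κ - lo κ + 3 < (P.sitesPerDir k : ℤ)) {ν : Fin P.d}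
    {s : Bool} {x : Fin P.d → ℤ} (hx : faceLo lo hi ν s ≤ x ∧ x ≤ faceHi lo hi ν s) :
    (castSite x : Site P k) ∉ boxSites lo hi := by
  have hbig := face_mem_big hlohi hx
  rw [mem_faceBox_iff] at hx
  refine castSite_not_mem_boxSites hN hbig.1 (fun κ => by have := hbig.2 κ; linarith) (ν := ν) ?_
  rw [hx.1]
  exact faceCoord_not_mem ν s

/-- `y ↦ y + e_μ` is injective on the torus. [folklore] -/
private theorem shift_injective (μ : Fin P.d) : Function.Injective fun y : Site P k => y.shift μ := by
  intro y y' h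
  funext κ
  have hκ := congr_fun h κ
  simp only [Site.shift, Function.update_apply] at hκ
  by_cases hκμ : κ = μ
  · subst hκμ
    simp only [if_true] at hκ
    exact add_right_cancel hκ
  · simpa [hκμ] using hκ

/-- **`∂⁺Λ` OF A BOX IS COVERED BY THE `2d` FACES**: a point off `Λ` with a nearest neighbour in `Λ` is the image of a point
of some face box. [cite: Balaban1989LargeFieldI, p.193] -/
theorem exists_face_of_mem_bdPlus {y : Site P k} (hy : y ∈ bdPlus (boxSites lo hi)) :
    ∃ (ν : Fin P.d) (s : Bool) (x : Fin P.d → ℤ),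
      (faceLo lo hi ν s ≤ x ∧ x ≤ faceHi lo hi ν s) ∧ castSite x = y := by
  obtain ⟨hyΛ, x₀, ⟨z, hz, hz', rfl⟩, μ, h⟩ := hy
  rcases h with h | h
  · -- `y = z + e_μ`
    have hyz : y = castSite (z + e μ) := by rw [h, castSite_add_e]
    refine ⟨μ, true, z + e μ, ?_, hyz.symm⟩
    rw [mem_faceBox_iff]
    have hzμ : z μ = hi μ := by
      rcases (hz' μ).lt_or_eq with hlt | heq
      · exfalso
        apply hyΛ
        rw [hyz]
        refine ⟨z + e μ, fun κ => ?_, fun κ => ?_, rfl⟩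
        · have := hz κ; have h0 : (0:ℤ) ≤ e μ κ := e_nonneg μ κ; simp only [Pi.add_apply]; linarith
        · simp only [Pi.add_apply, e_apply]
          split_ifs with hκ
          · subst hκ; linarith
          · have := hz' κ; linarith
      · exact heq
    refine ⟨by simp [faceCoord, e_apply, hzμ], fun κ hκ => ?_⟩
    simp only [Pi.add_apply, e_apply, if_neg hκ, add_zero]
    exact ⟨hz κ, hz' κ⟩
  · -- `z = y + e_μ`, i.e. `y = z − e_μ`
    have hyz : y = castSite (z - e μ) := by
      apply shift_injective μ
      show y.shift μ = (castSite (z - e μ)).shift μ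
      rw [← castSite_add_e, sub_add_cancel, h]
    refine ⟨μ, false, z - e μ, ?_, hyz.symm⟩
    rw [mem_faceBox_iff]
    have hzμ : z μ = lo μ := by
      rcases (hz μ).lt_or_eq with hlt | heq
      · exfalso
        apply hyΛ
        rw [hyz]
        refine ⟨z - e μ, fun κ => ?_, fun κ => ?_, rfl⟩
        · simp only [Pi.sub_apply, e_apply]
          split_ifs with hκ
          · subst hκ; linarith
          · have := hz κ; linarith
        · have := hz' κ; have h0 : (0:ℤ) ≤ e μ κ := e_nonneg μ κ; simp only [Pi.sub_apply]; linarith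
      · exact heq.symm
    refine ⟨by simp [faceCoord, e_apply, hzμ], fun κ hκ => ?_⟩
    simp only [Pi.sub_apply, e_apply, if_neg hκ, sub_zero]
    exact ⟨hz κ, hz' κ⟩

/-- **THE FACES ARE PAIRWISE DISJOINT**: a torus point is the image of at most one face point, of exactly one face.
[cite: Balaban1989LargeFieldI, p.193] -/
theorem face_unique (hlohi : lo ≤ hi) (hN : ∀ κ, hi κ - lo κ + 3 < (P.sitesPerDir k : ℤ)) {ν ν' : Fin P.d}
    {s s' : Bool} {x x' : Fin P.d → ℤ} (hx : faceLo lo hi ν s ≤ x ∧ x ≤ faceHi lo hi ν s)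
    (hx' : faceLo lo hi ν' s' ≤ x' ∧ x' ≤ faceHi lo hi ν' s') (h : (castSite x : Site P k) = castSite x') :
    x = x' ∧ ν = ν' ∧ s = s' := by
  have hb := face_mem_big hlohi hx
  have hb' := face_mem_big hlohi hx'
  have heq : x = x' := castSite_inj_big hN hb.1 (fun κ => by have := hb.2 κ; linarith) hb'.1
    (fun κ => by have := hb'.2 κ; linarith) h
  subst heq
  rw [mem_faceBox_iff] at hx hx'
  have hν : ν = ν' := by
    by_contra hne
    have hr := hx'.2 ν hne
    rw [hx.1] at hr
    exact faceCoord_not_mem ν s hr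
  subst hν
  exact ⟨rfl, rfl, faceCoord_inj hlohi (hx.1.symm.trans hx'.1)⟩

/-- **NO BOND JOINS TWO DIFFERENT FACES; EVERY SURFACE BOND IS A BOND OF ONE FACE BOX**: for `b′ ⊂ ∂⁺Λ` there are a face
`(ν, s)` and an integer point `x` with `b′ = ⟨x, x + e_κ⟩`, `faceLo ≤ x`, `x + e_κ ≤ faceHi` (so `κ ≠ ν`).
[cite: Balaban1989LargeFieldI, p.193] -/
theorem surfBond_face (hlohi : lo ≤ hi) (hN : ∀ κ, hi κ - lo κ + 3 < (P.sitesPerDir k : ℤ)) {b : PBond P k}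
    (hb : b ∈ surfBonds (boxSites lo hi)) :
    ∃ (ν : Fin P.d) (s : Bool) (x : Fin P.d → ℤ),
      faceLo lo hi ν s ≤ x ∧ x + e b.dir ≤ faceHi lo hi ν s ∧ b.src = castSite x := by
  obtain ⟨ν, s, x, hx, hsrc⟩ := exists_face_of_mem_bdPlus hb.1
  obtain ⟨ν', s', x', hx', htgt⟩ := exists_face_of_mem_bdPlus hb.2
  have htgt' : b.tgt = castSite (x + e b.dir) := by rw [castSite_add_e, hsrc]; rfl
  -- the representative of the far end is `x + e_κ`
  have hb1 := face_mem_big hlohi hx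
  have hb2 := face_mem_big hlohi hx'
  have heq : x' = x + e b.dir :=
    castSite_inj_big hN hb2.1 (fun κ => by have := hb2.2 κ; linarith)
      (fun κ => by have := hb1.1 κ; have h0 : (0:ℤ) ≤ e b.dir κ := e_nonneg b.dir κ; simp only [Pi.add_apply]; linarith)
      (fun κ => by
        have := hb1.2 κ; simp only [Pi.add_apply, e_apply]; split_ifs <;> linarith)
      (htgt.trans htgt')
  subst heq
  rw [mem_faceBox_iff] at hx hx'
  -- the two faces coincide
  have hν : ν' = ν := by
    by_contra hne
    have hr := hx'.2 ν (Ne.symm hne)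
    simp only [Pi.add_apply, e_apply, hx.1] at hr
    split_ifs at hr with hdir
    · -- `κ = ν`: then the `ν'`-coordinate of `x' = x + e_ν` is that of `x`, in range and out of range at once
      have hr' := hx.2 ν' hne
      have h1 := hx'.1
      have hνν' : ν' ≠ b.dir := fun h => hne (h.trans hdir.symm)
      simp only [Pi.add_apply, e_apply, if_neg hνν', add_zero] at h1
      rw [h1] at hr'
      exact faceCoord_not_mem ν' s' hr'
    · simp only [add_zero] at hr
      exact faceCoord_not_mem ν s hr
  subst hν
  have hdir : b.dir ≠ ν' := by
    intro hd
    have h1 := hx'.1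
    simp only [Pi.add_apply, e_apply, if_pos hd.symm, hx.1] at h1
    have := hlohi ν'
    revert h1
    cases s <;> cases s' <;> simp [faceCoord] <;> intro h1 <;> linarith
  have hs : s' = s := by
    have h1 := hx'.1
    simp only [Pi.add_apply, e_apply, if_neg hdir.symm, add_zero, hx.1] at h1
    exact (faceCoord_inj hlohi h1).symm
  subst hs
  refine ⟨ν', s', x, (mem_faceBox_iff.2 hx).1, (mem_faceBox_iff.2 hx').2, hsrc.symm⟩

/-- **THE PLAQUETTES OF A FACE BOX LIE IN `Λᶜ`**: `boxPlaqs (faceLo ν s) (faceHi ν s) ⊆ outPlaqs Λ` — the given regularity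
on `Z∩Λᶜ` covers the plaquettes used by the face-wise axial gauge. [cite: Balaban1989LargeFieldI, p.193] -/
theorem boxPlaqs_face_subset_outPlaqs (hlohi : lo ≤ hi) (hN : ∀ κ, hi κ - lo κ + 3 < (P.sitesPerDir k : ℤ))
    (ν : Fin P.d) (s : Bool) :
    boxPlaqs (faceLo lo hi ν s) (faceHi lo hi ν s) ⊆ outPlaqs (boxSites (k := k) lo hi) := by
  rintro p ⟨z, hz, hz', hsrc⟩ c hc
  have hμ := e_nonneg (d := P.d) p.μ
  have hν' := e_nonneg (d := P.d) p.ν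
  have hmem : ∀ w : Fin P.d → ℤ, faceLo lo hi ν s ≤ w → w ≤ faceHi lo hi ν s →
      (castSite w : Site P k) ∉ boxSites lo hi := fun w h1 h2 => castSite_face_not_mem hlohi hN ⟨h1, h2⟩
  rw [mem_corners_iff] at hc
  rcases hc with rfl | rfl | rfl | rfl
  · rw [hsrc]
    exact hmem z hz (le_trans (le_trans (le_add_of_nonneg_right hμ) (le_add_of_nonneg_right hν')) hz')
  · rw [hsrc, ← castSite_add_e]
    exact hmem _ (hz.trans (le_add_of_nonneg_right hμ)) ((le_add_of_nonneg_right hν').trans hz')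
  · rw [hsrc, ← castSite_add_e]
    refine hmem _ (hz.trans (le_add_of_nonneg_right hν')) (le_trans ?_ hz')
    rw [add_right_comm]; exact le_add_of_nonneg_right hμ
  · rw [hsrc, ← castSite_add_e, ← castSite_add_e]
    exact hmem _ ((hz.trans (le_add_of_nonneg_right hμ)).trans (le_add_of_nonneg_right hν')) hz'

variable [GaugeGroup G]

open Classical in
/-- **THE SURFACE GAUGE OF A BOX** (*"Introduce a generalized axial gauge on the surface ∂⁺Λ"*, p. 193): on each face
`(ν, s)` the axial gauge of `T4AxialGaugeSmallField` rooted at the corner of that face box; `1` off `∂⁺Λ`.  Well defined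
because the faces are pairwise disjoint (`face_unique`). [cite: Balaban1989LargeFieldI, p.193] -/
def faceGauge (V : GaugeField P k G) (lo hi : Fin P.d → ℤ) : GaugeTransf P k G := fun y =>
  if h : ∃ q : Fin P.d × Bool, y ∈ faceSites (k := k) lo hi q.1 q.2 then
    axialGauge V (faceLo lo hi h.choose.1 h.choose.2) (faceHi lo hi h.choose.1 h.choose.2) y
  else 1

/-- On the face `(ν, s)` the surface gauge IS that face's axial gauge. [cite: Balaban1989LargeFieldI, p.193] -/
theorem faceGauge_castSite (V : GaugeField P k G) (hlohi : lo ≤ hi) (hN : ∀ κ, hi κ - lo κ + 3 < (P.sitesPerDir k : ℤ))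
    {ν : Fin P.d} {s : Bool} {x : Fin P.d → ℤ} (hx : faceLo lo hi ν s ≤ x ∧ x ≤ faceHi lo hi ν s) :
    faceGauge V lo hi (castSite x) = axialGauge V (faceLo lo hi ν s) (faceHi lo hi ν s) (castSite x) := by
  have hex : ∃ q : Fin P.d × Bool, (castSite x : Site P k) ∈ faceSites (k := k) lo hi q.1 q.2 :=
    ⟨(ν, s), x, hx.1, hx.2, rfl⟩
  unfold faceGauge
  rw [dif_pos hex]
  obtain ⟨x', hx'1, hx'2, hx'3⟩ := hex.choose_spec
  obtain ⟨-, hν, hs⟩ := face_unique hlohi hN ⟨hx'1, hx'2⟩ hx hx'3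
  rw [← hν, ← hs]

/-- **THE SURFACE-GAUGE BOUND FOR A BOX** (*"|V′_k(b′) − 1| < O(1)M²ε for b′ ⊂ ∂⁺Λ"*, p. 193), PROVED with the constant
`(d − 1)·n` for a box of at most `n + 1` sites per direction: plaquette-small `< ε` on the plaquettes of `Λᶜ` ⟹ in the
face-wise axial gauge every surface bond satisfies `|V^g(b′) − 1| ≤ (d − 1)·n·ε`
(`T4AxialGaugeSmallField.dist1_gaugeAct_axialGauge_le_uniform` BY NAME, on the face box of the bond).
[cite: Balaban1989LargeFieldI, p.193] -/
theorem dist1_faceGauge_le (V : GaugeField P k G) (hlohi : lo ≤ hi) {n : ℕ} (hn : ∀ κ, hi κ ≤ lo κ + n)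
    (hnN : n < P.sitesPerDir k) (hN : ∀ κ, hi κ - lo κ + 3 < (P.sitesPerDir k : ℤ)) {ε : ℝ} (hε : 0 ≤ ε)
    (hV : PlaqSmallOn (outPlaqs (boxSites lo hi)) ε V) {b : PBond P k} (hb : b ∈ surfBonds (boxSites lo hi)) :
    dist1 (gaugeAct (faceGauge V lo hi) V b) ≤ ((P.d - 1 : ℕ) : ℝ) * n * ε := by
  obtain ⟨ν, s, x, hx, hxe, hsrc⟩ := surfBond_face hlohi hN hb
  have hx' : x ≤ faceHi lo hi ν s := (le_add_of_nonneg_right (e_nonneg b.dir)).trans hxe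
  have hxe' : faceLo lo hi ν s ≤ x + e b.dir := hx.trans (le_add_of_nonneg_right (e_nonneg b.dir))
  have htgt : b.tgt = castSite (x + e b.dir) := by rw [castSite_add_e, ← hsrc]; rfl
  have hrew : gaugeAct (faceGauge V lo hi) V b =
      gaugeAct (axialGauge V (faceLo lo hi ν s) (faceHi lo hi ν s)) V ⟨castSite x, b.dir⟩ := by
    have h1 := faceGauge_castSite V hlohi hN ⟨hx, hx'⟩
    have h2 := faceGauge_castSite V hlohi hN ⟨hxe', hxe⟩
    obtain ⟨src, dir⟩ := b
    simp only at hsrc htgt hxe h1 h2 ⊢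
    subst hsrc
    simp only [GaugeField.gaugeAct, PBond.tgt] at htgt ⊢
    rw [h1, htgt, h2]
  rw [hrew]
  have hnF : ∀ κ, faceHi lo hi ν s κ ≤ faceLo lo hi ν s κ + n := fun κ => by
    simp only [faceHi, faceLo, Function.update_apply]
    split_ifs
    · simp
    · exact hn κ
  exact dist1_gaugeAct_axialGauge_le_uniform V (boxPlaqs_face_subset_outPlaqs hlohi hN ν s) hV hε hnF hnN hx hxe

end Box

/-! ## §4  Assembly: the extension lemma for a parallelepiped, and the typed leaf `Extension193` -/

section Assembly

variable [GaugeGroup G] {lo hi : Fin P.d → ℤ}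

/-- **THE EXTENSION LEMMA OF p. 193 FOR A PARALLELEPIPED `Λ`, PROVED**: for `Λ = boxSites lo hi` (at most `n + 1` sites per
direction, non-wrapping with margin) and a configuration `V` with `|V(∂p′) − 1| < ε` on the plaquettes of `Λᶜ`, the
configuration `V̂ = extend Λ (faceGauge V lo hi) V` (i) *"is equal to the given one on Z∩Λ^c"* (bonds of `Λᶜ`), (ii) keeps
the plaquette variables of `Λᶜ`, (iii) satisfies `|V̂(∂p′) − 1| ≤ 4(d − 1)·n·ε` for every `p′ ⊂ Λ∪∂⁺Λ` — the printed
`O(1)M²ε` with `O(1)M² ↤ 4(d − 1)(M − 1)` for an `M`-cube. [cite: Balaban1989LargeFieldI, p.193] -/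
theorem extension_box (V : GaugeField P k G) (hlohi : lo ≤ hi) {n : ℕ} (hn : ∀ κ, hi κ ≤ lo κ + n)
    (hnN : n < P.sitesPerDir k) (hN : ∀ κ, hi κ - lo κ + 3 < (P.sitesPerDir k : ℤ)) {ε : ℝ} (hε : 0 ≤ ε)
    (hV : PlaqSmallOn (outPlaqs (boxSites lo hi)) ε V) :
    (∀ b ∈ outBonds (boxSites lo hi), extend (boxSites lo hi) (faceGauge V lo hi) V b = V b) ∧
      (∀ p ∈ outPlaqs (boxSites lo hi),
        plaqHol (extend (boxSites lo hi) (faceGauge V lo hi) V) p = plaqHol V p) ∧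
      ∀ p ∈ nearPlaqs (boxSites lo hi),
        dist1 (plaqHol (extend (boxSites lo hi) (faceGauge V lo hi) V) p) ≤ 4 * (((P.d - 1 : ℕ) : ℝ) * n * ε) :=
  extension_of_surfaceGauge (faceGauge V lo hi) V (by positivity)
    fun _ hb => dist1_faceGauge_le V hlohi hn hnN hN hε hV hb

/-- A plaquette all of whose corners have every coordinate beyond `hi` — a witness that `outPlaqs Λ` is nonempty as soon as
there is a plaquette at all (used to read `ε > 0` off the hypothesis). [cite: Balaban1989LargeFieldI, p.193] -/
theorem corner_plaq_mem_outPlaqs (hlohi : lo ≤ hi) (hN : ∀ κ, hi κ - lo κ + 3 < (P.sitesPerDir k : ℤ)) (p : Plaq P k) :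
    (⟨castSite (fun κ => hi κ + 1), p.μ, p.ν, p.hμν⟩ : Plaq P k) ∈ outPlaqs (boxSites lo hi) := by
  intro c hc
  have hμ : ∀ κ, (0:ℤ) ≤ e p.μ κ := fun κ => e_nonneg (d := P.d) p.μ κ
  have hν : ∀ κ, (0:ℤ) ≤ e p.ν κ := fun κ => e_nonneg (d := P.d) p.ν κ
  have key : ∀ w : Fin P.d → ℤ, (∀ κ, hi κ + 1 ≤ w κ) → (∀ κ, w κ ≤ hi κ + 2) →
      (castSite w : Site P k) ∉ boxSites lo hi := fun w h1 h2 =>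
    castSite_not_mem_boxSites hN (fun κ => by have := h1 κ; have := hlohi κ; linarith) h2 (ν := p.μ)
      (fun h => by have := h1 p.μ; linarith [h.2])
  have hb2 : ∀ κ, ((fun κ => hi κ + 1) + e p.μ + e p.ν) κ ≤ hi κ + 2 := fun κ => by
    have hne := p.hμν.ne
    simp only [Pi.add_apply, e_apply]
    split_ifs with h1 h2 <;> omega
  rw [mem_corners_iff] at hc
  simp only at hc
  rcases hc with rfl | rfl | rfl | rfl
  · exact key _ (fun κ => le_rfl) (fun κ => by linarith)
  · rw [← castSite_add_e]
    exact key _ (fun κ => by have := hμ κ; simp only [Pi.add_apply]; linarith)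
      (fun κ => by have hb := hb2 κ; have h0 := hν κ; simp only [Pi.add_apply] at hb ⊢; linarith)
  · rw [← castSite_add_e]
    exact key _ (fun κ => by have := hν κ; simp only [Pi.add_apply]; linarith)
      (fun κ => by have hb := hb2 κ; have h0 := hμ κ; simp only [Pi.add_apply] at hb ⊢; linarith)
  · rw [← castSite_add_e, ← castSite_add_e]
    exact key _ (fun κ => by have := hμ κ; have := hν κ; simp only [Pi.add_apply]; linarith) hb2

/-- **THE TYPED LEAF `B15.PrelimIntegrations.Extension193` PROVED FOR A PARALLELEPIPED** (row `B15.Lem@193`): with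
`outB` = the bonds of `Λᶜ`, `outP` = the plaquettes of `Λᶜ`, `allP` = the plaquettes `p′ ⊂ Λ∪∂⁺Λ` or `p′ ⊂ Λᶜ` (reading
note (R2)), the constant `C = 4(d − 1)` and any `M ≥ n + 1` (the number of sites per direction): for EVERY `ε` and every
`ε`-regular `V` on `Λᶜ` there is an extension equal to `V` on `Λᶜ` with `|V̂(∂p′) − 1| < 4(d − 1)M²ε` on `allP`.
[cite: Balaban1989LargeFieldI, p.193] -/
theorem extension193_box (hlohi : lo ≤ hi) {n : ℕ} (hn : ∀ κ, hi κ ≤ lo κ + n) (hnN : n < P.sitesPerDir k)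
    (hN : ∀ κ, hi κ - lo κ + 3 < (P.sitesPerDir k : ℤ)) {M : ℝ} (hM : (n : ℝ) + 1 ≤ M) (ε : ℝ) :
    B15.PrelimIntegrations.Extension193 (k := k) (G := G) (outBonds (boxSites lo hi)) (outPlaqs (boxSites lo hi))
      (allPlaqs (boxSites lo hi)) (4 * ((P.d - 1 : ℕ) : ℝ)) M ε := by
  intro V hV
  refine ⟨extend (boxSites lo hi) (faceGauge V lo hi) V, fun b hb => extend_eq_of_mem_outBonds _ V hb,
    fun p hp => ?_⟩
  -- a plaquette exists, so `d ≥ 2` and `ε > 0`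
  have hd : 2 ≤ P.d := by have := p.hμν; have := p.ν.isLt; omega
  have hε : 0 < ε := lt_of_le_of_lt (GaugeGroup.dist1_nonneg _) (hV _ (corner_plaq_mem_outPlaqs hlohi hN p))
  have hd1 : (1 : ℝ) ≤ ((P.d - 1 : ℕ) : ℝ) := by
    have : 1 ≤ P.d - 1 := by omega
    exact_mod_cast this
  have hM1 : (1 : ℝ) ≤ M := by have : (0 : ℝ) ≤ n := n.cast_nonneg; linarith
  have hnM : (n : ℝ) < M ^ 2 := by nlinarith
  obtain ⟨-, hplaq, hnear⟩ := extension_box V hlohi hn hnN hN hε.le hV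
  rcases hp with hp | hp
  · calc dist1 (plaqHol (extend (boxSites lo hi) (faceGauge V lo hi) V) p)
        ≤ 4 * (((P.d - 1 : ℕ) : ℝ) * n * ε) := hnear p hp
      _ < 4 * ((P.d - 1 : ℕ) : ℝ) * M ^ 2 * ε := by
          have : ((P.d - 1 : ℕ) : ℝ) * n * ε < ((P.d - 1 : ℕ) : ℝ) * M ^ 2 * ε := by
            apply mul_lt_mul_of_pos_right _ hε
            exact mul_lt_mul_of_pos_left hnM (by linarith)
          linarith
  · rw [hplaq p hp]
    calc dist1 (plaqHol V p) < ε := hV p hp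
      _ ≤ 4 * ((P.d - 1 : ℕ) : ℝ) * M ^ 2 * ε := by
          have : (1 : ℝ) ≤ 4 * ((P.d - 1 : ℕ) : ℝ) * M ^ 2 := by nlinarith
          nlinarith

/-- THE `M`-CUBE FORM of the previous theorem: a cube of `M ≥ 1` sites per direction (`hi = lo + (M − 1)`), the printed
parameter of p. 193 (`Λ` a union of `M`-cubes; here one cube). [cite: Balaban1989LargeFieldI, p.193] -/
theorem extension193_cube {M : ℕ} (hM : 1 ≤ M) (hMN : (M : ℤ) + 2 < (P.sitesPerDir k : ℤ))
    (hcube : ∀ κ, hi κ = lo κ + (M - 1 : ℕ)) (ε : ℝ) :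
    B15.PrelimIntegrations.Extension193 (k := k) (G := G) (outBonds (boxSites lo hi)) (outPlaqs (boxSites lo hi))
      (allPlaqs (boxSites lo hi)) (4 * ((P.d - 1 : ℕ) : ℝ)) M ε := by
  have hlohi : lo ≤ hi := fun κ => by rw [hcube κ]; simp
  have hn : ∀ κ, hi κ ≤ lo κ + (M - 1 : ℕ) := fun κ => (hcube κ).le
  have hnN : M - 1 < P.sitesPerDir k := by
    have : ((M - 1 : ℕ) : ℤ) < P.sitesPerDir k := by push_cast [Nat.cast_sub hM]; linarith
    exact_mod_cast this
  have hN : ∀ κ, hi κ - lo κ + 3 < (P.sitesPerDir k : ℤ) := fun κ => by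
    rw [hcube κ]; push_cast [Nat.cast_sub hM]; linarith
  have hMr : (((M - 1 : ℕ) : ℕ) : ℝ) + 1 ≤ (M : ℝ) := by push_cast [Nat.cast_sub hM]; linarith
  exact extension193_box hlohi hn hnN hN hMr ε

end Assembly

end Literature.MathematicalPhysics.QuantumFieldTheory.Balaban1983to89.B15Extension193
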